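import Literature.MathematicalPhysics.QuantumFieldTheory.Balaban1983to89.Node00.Record12MinimiserSelection
import Literature.MathematicalPhysics.QuantumFieldTheory.Balaban1983to89.Node00.BackgroundActionOfRecord

/-!
# NODE N09 — THE (H-U) FACE IS INHABITED AT THE (0.21) PROBLEM OF RECORD BY A MEASURABLE MINIMISER SELECTION, and the
# bare-choice `U_k`'s gauge-invariant shadow `A^η(U_k(·))` (`wilsonBGOfRecord`) IS MEASURABLE — UNCONDITIONALLY

TRACK A (YM-PLAN §2d, node N09 of 28 = [Balaban1987RG1] Sects 2–5, `Dag.B12_main`), cell `pub-ymgap`, seat `pub-ymgap-dag-n09-w4` (g2; D-0149 width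
seat 4∕4, harness re-seat).  Key of record: K1⁷ `StabilityBAtRecordR13SepCoPH` = stmt-QuantumFields-20542; this file `--supports` it AS A HELPER
(Summits lane, count-neutral).  [I] = [Balaban1987RG1] (CMP 109), [B11] = [Balaban1985Variational] (CMP 102), [III] = [Balaban1988Convergent] (CMP 119).

WHY.  N09's Theorem-3 member at the Stage-13 record (dag-n24-c's junction `B12NodeKnitRecord13SepCoPH` v1.1∕v1.2,
`thm3Member_stage13SepCoPH_of_regSets_of_measurableUk` ∕ `…_of_covariant_of_measurableUk`; dag-n09-w2's re-keyed ★ `thm3Member_stage13SepCoPH_of_stepsOnLoc`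
keeps its (I19) image `hint`) displays the binder
  (H-U) `hU : ∀ k < P.K, Measurable (Uk F N P.K (k+1) θ.ν.εreg)`,
the MEASURABILITY OF THE MINIMISER SELECTION `W ↦ U_{k+1}(W)` behind the critical configuration (2.3) and the (2.9) cut-off (node00-def-K0e
`Node00/SmallFieldChi29OfRecord.measurable_critCfgOfRecord_of` ∕ `Node00/BetaInputIntegrable` §3 — the ONLY tree supplier of (I19)).  node00-def-B's
`Uk F N K k ε V := if h : UkExists … V then Classical.choose h else 1` ([I] (0.21) p. 256, `Node00/BackgroundActionOfRecord`) is a bare pointwise choice: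
(H-U) for it is unprovable BY DESIGN (the junction's located note: «print's axial-gauge measurable minimiser has both [selection properties]; the record's bare
`Classical.choose` has no theorem for either»).  THIS FILE runs node00-def-K0c's `Node00/Record12MinimiserSelection` pattern (there: the (2.12) [III] box
minimisers; dag-n11-d: the CoP background; dag-n08-d: the d = 3 (42) minimisers) for the (0.21) problem itself — nothing of record is re-pointed:
* §1 ★ `exists_measurable_isBackground_selector K k ε` — there is a MEASURABLE `f : GaugeField (F.P K) k SU(N) → GaugeField (F.P K) 0 SU(N)` with
  `IsBackground (avOfRecord F N K) (bgReg F N K k ε) k V (f V)` at every solvable `V` (`UkExists`) and `f V = 1` elsewhere — EXACTLY the values-level contract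
  of `Uk` (`isBackground_Uk` ∕ `Uk_of_not`): minimise the continuous Wilson action (0.2) over the OPEN class `bgReg` (strict (1.2)) under the CLOSED constraint
  `M^k U = V`, `M^k` σ-closed-continuous (K0c §2 `sigmaClosedContinuous_iter`), on the compact Polish `SU(N)^{bonds}` ⇒
  `Literature.MeasureTheory.RandomSets.exists_measurable_constrained_argmin`.  [B11] Thm 1 is NOT used (a selector needs neither existence nor uniqueness).
* §2 THE CONTRACT OF ANY SUCH SELECTOR against `Uk`: `wilsonAction4_eq_Uk_of_selector` — `A(f V) = A(U_k(V))` for EVERY `V` (mutual minimality,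
  node00-def-B's `wilsonAction4_eq_of_isBackground`; both `= A(1)` off the solvable set); `wilsonBGOfRecord_eq_comp_of_selector` — `wilsonBGOfRecord F N ε p k =
  wilsonAction4 ∘ f`; `orbitRel_Uk_of_selector` — under `UkExists ∧ UniqueUkOrbit` at `V` ([B11] Thm 1, DISPLAYED) `OrbitRel k (U_k(V)) (f V)`: the re-point
  moves `U_k(V)` inside its minimal orbit only; `measurable_iter_comp_of_measurable` — the (2.3)-shaped critical configuration `W ↦ M^j(f W)` is measurable
  (the consumer shape of `measurable_critCfgOfRecord_of` with `Uk ↦ f`).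
* §3 ★★ `measurable_wilsonBGOfRecord ε p k : Measurable (wilsonBGOfRecord F N ε p k)` — HYPOTHESIS-FREE: the background Wilson action of record
  `A^η(U_k(V))` ([I] (0.22) p. 256; the value `Residual₅.wilsonBG` carries, read e.g. by the density row's lower bound `χ·exp(−g⁻²·A^η(U_k))`) is a
  MEASURABLE function of `V` although `U_k` is a bare choice — it factors through §1's selector by §2; `integrable_exp_neg_mul_wilsonBGOfRecord` — for
  `0 ≤ c`, `V ↦ exp(−c·A^η(U_k(V)))` is integrable for the product Haar probability `fieldMeasure`; `exists_measurable_Uk_twin` packages §1–§2 in one line.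

LOCATED READING (for node00-def-B ∕ K0e ∕ def-T ∕ plan; NOT this seat's to re-point).  (H-U) for the CURRENT `Uk` stays exactly as located.  `critCfgOfRecord` and
`chiFix29OfRecord` read the REPRESENTATIVE `U_{k+1}(W)`, not its orbit, so (H-U) ∕ (I19) at the record become theorems only after the ONE-TOKEN re-point
`Uk := a measurable selector` (this file = the drop-in's existence and its contract: same `IsBackground` ∕ junk-default interface, same `wilsonBGOfRecord`, same
minimal orbit).  The OTHER selection property — [B11] (181) p. 307 block-lift COVARIANCE on the solvable set (dag-n09-w2's reduction of (M1),
`…N09LiftInvariance29AtRecord` §1) — is NOT claimed: a measurable AND covariant selector amounts to an axial gauge fixing of the selected orbit (successor piece).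

HONEST FRAMING — what this is NOT.  Kernel measure theory over NODE 00's definitions of record (compactness of `SU(N)^{bonds}`, continuity of the Wilson action,
K0c's σ-closed continuity of the averaging of record, a selection theorem, mutual minimality); NOTHING of Bałaban's asserted ([B11] Thm 1 appears only as the
hypotheses `UkExists` ∕ `UniqueUkOrbit` of §2's orbit clause); NO carrier of record re-pointed; NOT a discharge of N09; K0⁷ ∕ K1⁷ NOT closed; counts unmoved
(typed 28∕28 · discharged 5∕27); one finite four-torus programme at fixed `ε = L^{−K}` — R4 closes the conditional rung `BalabanLadder.UV` only; NOT continuum ∕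
ℝ⁴ ∕ OS; the YM mass gap (Clay) is NOT proved by any of this.  THEOREMS ONLY (0 `def`, 0 `sorry`, 0 `instance` — local `haveI` as in K0c —, 0 `notation`).
-/

noncomputable section

namespace Summit.QuantumFields.YangMills.BalabanUVNodes.N09UkMeasurableSelector

open MeasureTheory Set Topology TopologicalSpace
open Literature.MathematicalPhysics.QuantumFieldTheory.Balaban1983to89
open Literature.MathematicalPhysics.QuantumFieldTheory.Balaban1983to89.Node00
open Literature.MeasureTheory.RandomSets
open Literature.MathematicalPhysics.QuantumLattice (fundamentalRep continuous_fundamentalRep fundamentalRep_injective)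
open B12GaugeOrbits021 (OrbitRel)

variable {F : T4Continuum.T4Family} {N : ℕ} [NeZero N]

/-! ## §0  Topology of the configuration spaces `SU(N)^{bonds}` (private copies, as in K0c's `Record12MinimiserSelection` §1) -/

section Topology

variable {P : Params} {j : ℕ}

/-- `Re tr` is continuous on `SU(N)`. [folklore] -/
private theorem continuous_reTr_SU' : Continuous (reTr : SU N → ℝ) :=
  UnitaryModel.continuous_nReTr.comp (continuous_fundamentalRep (Fin N))

/-- Plaquette variables are continuous in the configuration. [folklore] -/
private theorem continuous_plaqHol' (p : Plaq P j) : Continuous fun U : GaugeField P j (SU N) => GaugeField.plaqHol U p := by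
  have hb : ∀ b : PBond P j, Continuous fun U : GaugeField P j (SU N) => U b := fun b => continuous_apply b
  unfold GaugeField.plaqHol
  exact (((hb _).mul (hb _)).mul (hb _).inv).mul (hb _).inv

/-- The Wilson action (0.2) is a continuous function of the configuration. [cite: Balaban1987RG1, (0.2) p.252 (bookkeeping)] -/
private theorem continuous_wilsonAction4' : Continuous (wilsonAction4 : GaugeField P j (SU N) → ℝ) := by
  unfold wilsonAction4 wilsonAction
  exact continuous_finsetSum _ fun p _ =>
    continuous_const.mul (continuous_const.sub (continuous_reTr_SU'.comp (continuous_plaqHol' p)))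

omit [NeZero N] in
/-- `SU(N)` is second countable (closed embedding into the matrices). [folklore] -/
private theorem secondCountableTopology_SU' : SecondCountableTopology (SU N) := by
  haveI := secondCountableTopology_matrix (n := Fin N)
  exact ((continuous_fundamentalRep (Fin N)).isClosedEmbedding (fundamentalRep_injective (Fin N))).isEmbedding.secondCountableTopology

omit [NeZero N] in
/-- `SU(N)` is Polish (closed embedding into the matrices). [folklore] -/
private theorem polishSpace_SU' : PolishSpace (SU N) := by
  haveI : PolishSpace (Matrix (Fin N) (Fin N) ℂ) := inferInstanceAs (PolishSpace (Fin N → Fin N → ℂ))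
  exact ((continuous_fundamentalRep (Fin N)).isClosedEmbedding (fundamentalRep_injective (Fin N))).polishSpace

omit [NeZero N] in
/-- The product σ-algebra of `Setup` on `SU(N)^{bonds}` is the Borel σ-algebra of the product topology. [folklore] -/
private theorem borelSpace_gaugeField' : BorelSpace (GaugeField P j (SU N)) := by
  haveI := secondCountableTopology_SU' (N := N)
  exact inferInstanceAs (BorelSpace (PBond P j → SU N))

/-- The Wilson action (0.2) is a MEASURABLE function of the configuration. [cite: Balaban1987RG1, (0.2) p.252 (bookkeeping)] -/
theorem measurable_wilsonAction4 : Measurable (wilsonAction4 : GaugeField P j (SU N) → ℝ) := by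
  haveI := borelSpace_gaugeField' (N := N) (P := P) (j := j)
  exact continuous_wilsonAction4'.measurable

/-- The regularity class `bgReg F N K k ε = {U | |U(∂p) − 1| < ε η_k²}` of (1.2) is OPEN (strict inequalities between continuous functions;
K0c's `isOpen_plaqSmall`). [cite: Balaban1987RG1, (1.2) p.260 (bookkeeping)] -/
theorem isOpen_bgReg (K k : ℕ) (ε : ℝ) : IsOpen (bgReg F N K k ε) :=
  isOpen_plaqSmall (N := N) (P := F.P K) (j := 0) (ε * (F.P K).eta k ^ 2)

end Topology

/-! ## §1  ★ A measurable selector of the (0.21) minimisers of record -/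

/-- **THE (H-U) FACE IS INHABITED AT THE (0.21) PROBLEM OF RECORD.**  For every torus `K` of the family, every step `k` and every radius `ε` there is a
MEASURABLE map `f` from step-`k` configurations to fine configurations such that `f V` is a minimiser of the Wilson action over `{U ∈ bgReg | M^k U = V}`
— in node00-def-B's exact sense `IsBackground (avOfRecord F N K) (bgReg F N K k ε) k V (f V)` — whenever the problem is solvable at `V` (`UkExists F N K k ε V`),
and `f V = 1` otherwise: the SAME values-level contract as `Uk F N K k ε` (`isBackground_Uk` ∕ `Uk_of_not`), plus measurability.  (Compactness of `SU(N)^{bonds}`,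
continuity of `A`, openness of `bgReg`, K0c's σ-closed continuity of `M^k`, and `Literature.MeasureTheory.RandomSets.exists_measurable_constrained_argmin`;
[B11] Thm 1 — existence ∕ uniqueness modulo gauge of the minimal orbit — is NOT used.) [cite: Balaban1987RG1, (0.21) p.256 and (1.1)-(1.2) p.260] -/
theorem exists_measurable_isBackground_selector (K k : ℕ) (ε : ℝ) :
    ∃ f : GaugeField (F.P K) k (SU N) → GaugeField (F.P K) 0 (SU N), Measurable f ∧
      (∀ V, UkExists F N K k ε V → IsBackground (avOfRecord F N K) (bgReg F N K k ε) k V (f V)) ∧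
      (∀ V, ¬ UkExists F N K k ε V → f V = 1) := by
  -- the configuration spaces `SU(N)^{bonds}` are compact Polish with Borel = product σ-algebra
  haveI := secondCountableTopology_SU' (N := N)
  haveI := polishSpace_SU' (N := N)
  haveI : ∀ j, CompactSpace (GaugeField (F.P K) j (SU N)) := fun j => inferInstanceAs (CompactSpace (PBond (F.P K) j → SU N))
  haveI : PolishSpace (GaugeField (F.P K) 0 (SU N)) := inferInstanceAs (PolishSpace (PBond (F.P K) 0 → SU N))
  haveI : ∀ j, BorelSpace (GaugeField (F.P K) j (SU N)) := fun j => borelSpace_gaugeField' (N := N) (P := F.P K) (j := j)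
  -- the data map `π = id`, the piecewise-continuous constraint map `g = M^k`, the closed relation `R` = the diagonal
  let π : GaugeField (F.P K) k (SU N) → GaugeField (F.P K) k (SU N) := fun V => V
  let g : GaugeField (F.P K) 0 (SU N) → GaugeField (F.P K) k (SU N) := Averaging.iter (avOfRecord F N K) k
  let R : Set (GaugeField (F.P K) k (SU N) × GaugeField (F.P K) k (SU N)) := {p | p.1 = p.2}
  have hπ : Measurable π := measurable_id
  have hg : SigmaClosedContinuous g := sigmaClosedContinuous_iter F N K k
  have hR : IsClosed R := by
    have hcoord : ∀ b : PBond (F.P K) k, Continuous fun V : GaugeField (F.P K) k (SU N) => V b := fun b => continuous_apply b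
    have : R = ⋂ b : PBond (F.P K) k, {p : GaugeField (F.P K) k (SU N) × GaugeField (F.P K) k (SU N) | p.1 b = p.2 b} := by
      ext p
      simp only [R, mem_setOf_eq, mem_iInter]
      exact ⟨fun h b => by rw [h], fun h => funext h⟩
    rw [this]
    exact isClosed_iInter fun b => isClosed_eq ((hcoord b).comp continuous_fst) ((hcoord b).comp continuous_snd)
  have hadm : ∀ (U : GaugeField (F.P K) 0 (SU N)) (V : GaugeField (F.P K) k (SU N)),
      (U ∈ bgReg F N K k ε ∧ (g U, π V) ∈ R) ↔ (Averaging.iter (avOfRecord F N K) k U = V ∧ U ∈ bgReg F N K k ε) :=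
    fun U V => ⟨fun h => ⟨h.2, h.1⟩, fun h => ⟨h.2, h.1⟩⟩
  obtain ⟨f, hfm, hfin, hfout⟩ := exists_measurable_constrained_argmin hπ hg (isOpen_bgReg (F := F) (N := N) K k ε) hR
    (continuous_wilsonAction4' (N := N) (P := F.P K) (j := 0)) (1 : GaugeField (F.P K) 0 (SU N))
  refine ⟨f, hfm, fun V hV => ?_, fun V hV => ?_⟩
  · obtain ⟨U₀, hiter, hreg, hmin⟩ := hV
    have hex : ∃ y, (y ∈ bgReg F N K k ε ∧ (g y, π V) ∈ R) ∧
        ∀ z, z ∈ bgReg F N K k ε ∧ (g z, π V) ∈ R → wilsonAction4 y ≤ wilsonAction4 z :=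
      ⟨U₀, (hadm U₀ V).mpr ⟨hiter, hreg⟩, fun z hz => hmin z ((hadm z V).mp hz).2 ((hadm z V).mp hz).1⟩
    obtain ⟨hf₁, hf₂⟩ := hfin V hex
    obtain ⟨hfiter, hfreg⟩ := (hadm (f V) V).mp hf₁
    exact ⟨hfiter, hfreg, fun U hU hUV => hf₂ U ((hadm U V).mpr ⟨hUV, hU⟩)⟩
  · refine hfout V fun h => hV ?_
    obtain ⟨y, hy, hmin⟩ := h
    obtain ⟨hyiter, hyreg⟩ := (hadm y V).mp hy
    exact ⟨y, hyiter, hyreg, fun U hU hUV => hmin U ((hadm U V).mpr ⟨hUV, hU⟩)⟩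

/-! ## §2  The contract of any such selector against the bare-choice `Uk` of record -/

section Contract

variable {K k : ℕ} {ε : ℝ} {f : GaugeField (F.P K) k (SU N) → GaugeField (F.P K) 0 (SU N)}

/-- On the solvable set a selector's value lies in the fibre over `V`: `M^k(f V) = V`. [cite: Balaban1987RG1, (0.21) p.256] -/
theorem iter_selector (hsel : ∀ V, UkExists F N K k ε V → IsBackground (avOfRecord F N K) (bgReg F N K k ε) k V (f V))
    {V : GaugeField (F.P K) k (SU N)} (h : UkExists F N K k ε V) : Averaging.iter (avOfRecord F N K) k (f V) = V :=
  (hsel V h).1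

/-- On the solvable set a selector's value is regular: `f V ∈ bgReg` (first clause of (1.2)). [cite: Balaban1987RG1, (1.2) p.260] -/
theorem selector_mem_bgReg (hsel : ∀ V, UkExists F N K k ε V → IsBackground (avOfRecord F N K) (bgReg F N K k ε) k V (f V))
    {V : GaugeField (F.P K) k (SU N)} (h : UkExists F N K k ε V) : f V ∈ bgReg F N K k ε :=
  (hsel V h).2.1

/-- **SAME WILSON-ACTION VALUE EVERYWHERE**: `A(f V) = A(U_k(V))` for EVERY `V` — on the solvable set both are minimisers over `V` (mutual minimality,
node00-def-B's `wilsonAction4_eq_of_isBackground`); off it both are the unit configuration. [cite: Balaban1987RG1, (0.21)-(0.22) p.256] -/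
theorem wilsonAction4_eq_Uk_of_selector
    (hsel : ∀ V, UkExists F N K k ε V → IsBackground (avOfRecord F N K) (bgReg F N K k ε) k V (f V))
    (hout : ∀ V, ¬ UkExists F N K k ε V → f V = 1) (V : GaugeField (F.P K) k (SU N)) :
    wilsonAction4 (f V) = wilsonAction4 (Uk F N K k ε V) := by
  by_cases h : UkExists F N K k ε V
  · exact wilsonAction4_eq_of_isBackground (hsel V h)
  · rw [hout V h, Uk_of_not h]

/-- **SAME MINIMAL ORBIT** under [B11] Thm 1's uniqueness clause at `V` (DISPLAYED as `UniqueUkOrbit`, never asserted): `U_k(V)` and `f V` are two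
regular minimisers over `V`, hence in ONE orbit of the residual gauge group of level `k`. [cite: Balaban1985Variational, Thm 1 p.279] -/
theorem orbitRel_Uk_of_selector
    (hsel : ∀ V, UkExists F N K k ε V → IsBackground (avOfRecord F N K) (bgReg F N K k ε) k V (f V))
    {V : GaugeField (F.P K) k (SU N)} (h : UkExists F N K k ε V) (hu : UniqueUkOrbit F N K k ε V) :
    OrbitRel k (Uk F N K k ε V) (f V) :=
  hu _ _ (isBackground_Uk h) (hsel V h)

/-- Off the solvable set `U_k(V)` and `f V` COINCIDE (both are the documented junk default `1`). [cite: Balaban1987RG1, (0.21) p.256 (typing convention)] -/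
theorem selector_eq_Uk_of_not (hout : ∀ V, ¬ UkExists F N K k ε V → f V = 1)
    {V : GaugeField (F.P K) k (SU N)} (h : ¬ UkExists F N K k ε V) : f V = Uk F N K k ε V := by
  rw [hout V h, Uk_of_not h]

/-- Every iterate `M^j` of the averaging of record is measurable (node00-def's `avOfRecord_measurable`, composed).
[cite: Balaban1987RG1, (0.11) p.253 (bookkeeping)] -/
theorem measurable_iter_avOfRecord (K j : ℕ) : Measurable (Averaging.iter (avOfRecord F N K) j) := by
  induction j with
  | zero => exact measurable_id
  | succ j ih => exact (avOfRecord_measurable F N K j).comp ih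

/-- **THE (2.3)-SHAPED CRITICAL CONFIGURATION THROUGH A MEASURABLE SELECTOR IS MEASURABLE**: `W ↦ M^j(f W)` — K0e's `measurable_critCfgOfRecord_of` with
`Uk ↦ f`, its hypothesis now DISCHARGED by `Measurable f`. [cite: Balaban1987RG1, (2.3) p.265 (bookkeeping)] -/
theorem measurable_iter_comp_of_measurable {k' : ℕ} {f' : GaugeField (F.P K) k' (SU N) → GaugeField (F.P K) 0 (SU N)} (hf : Measurable f') (j : ℕ) :
    Measurable fun W => Averaging.iter (avOfRecord F N K) j (f' W) :=
  (measurable_iter_avOfRecord (F := F) (N := N) K j).comp hf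

end Contract

/-- **`A^η(U_k(·))` OF RECORD FACTORS THROUGH ANY SELECTOR**: `wilsonBGOfRecord F N ε p k = wilsonAction4 ∘ f`.
[cite: Balaban1987RG1, (0.22) p.256] -/
theorem wilsonBGOfRecord_eq_comp_of_selector (ε : ℝ) (p : B12.RunParams) (k : ℕ)
    {f : GaugeField (F.P p.K) k (SU N) → GaugeField (F.P p.K) 0 (SU N)}
    (hsel : ∀ V, UkExists F N p.K k ε V → IsBackground (avOfRecord F N p.K) (bgReg F N p.K k ε) k V (f V))
    (hout : ∀ V, ¬ UkExists F N p.K k ε V → f V = 1) :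
    wilsonBGOfRecord F N ε p k = wilsonAction4 ∘ f :=
  funext fun V => (wilsonAction4_eq_Uk_of_selector hsel hout V).symm

/-! ## §3  ★★ Unconditional consequences for the record's own objects -/

/-- **★★ THE BACKGROUND WILSON ACTION OF RECORD `V ↦ A^η(U_k(V))` IS MEASURABLE — HYPOTHESIS-FREE.**  `U_k` itself is a bare `Classical.choose`
(no measurability theorem), but its Wilson-action VALUE is canonical on the solvable set (mutual minimality) and `A(1)` off it, so it factors through
§1's measurable selector (§2) and the continuous action (0.2). [cite: Balaban1987RG1, (0.21)-(0.22) p.256] -/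
theorem measurable_wilsonBGOfRecord (ε : ℝ) (p : B12.RunParams) (k : ℕ) : Measurable (wilsonBGOfRecord F N ε p k) := by
  obtain ⟨f, hfm, hsel, hout⟩ := exists_measurable_isBackground_selector (F := F) (N := N) p.K k ε
  rw [wilsonBGOfRecord_eq_comp_of_selector ε p k hsel hout]
  exact (measurable_wilsonAction4 (N := N) (P := F.P p.K) (j := 0)).comp hfm

/-- `V ↦ A^η(U_k(V))` is strongly measurable (real-valued measurable). [cite: Balaban1987RG1, (0.22) p.256 (bookkeeping)] -/
theorem stronglyMeasurable_wilsonBGOfRecord (ε : ℝ) (p : B12.RunParams) (k : ℕ) : StronglyMeasurable (wilsonBGOfRecord F N ε p k) :=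
  (measurable_wilsonBGOfRecord (F := F) (N := N) ε p k).stronglyMeasurable

/-- **The Boltzmann-type factor `V ↦ exp(−c·A^η(U_k(V)))`, `0 ≤ c`, is INTEGRABLE** for the product Haar probability `fieldMeasure` on the step-`k`
configurations: measurable by `measurable_wilsonBGOfRecord`, bounded by `1` since `A^η ≥ 0` (`wilsonBGOfRecord_nonneg`).  (The shape of the lower-bound
integrand `χ·exp(−g_k⁻²·A^η(U_k))` of the density rows; `c = g_k⁻²`.) [cite: Balaban1987RG1, (0.22) p.256 and (1.3) p.260 (bookkeeping)] -/
theorem integrable_exp_neg_mul_wilsonBGOfRecord (ε : ℝ) (p : B12.RunParams) (k : ℕ) {c : ℝ} (hc : 0 ≤ c) :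
    Integrable (fun V => Real.exp (-(c * wilsonBGOfRecord F N ε p k V))) (fieldMeasure (F.P p.K) k (SU N)) := by
  have hm : Measurable fun V => Real.exp (-(c * wilsonBGOfRecord F N ε p k V)) :=
    Real.measurable_exp.comp ((measurable_wilsonBGOfRecord (F := F) (N := N) ε p k).const_mul c).neg
  refine Integrable.mono' (integrable_const (1 : ℝ)) hm.aestronglyMeasurable (Filter.Eventually.of_forall fun V => ?_)
  have h0 : 0 ≤ c * wilsonBGOfRecord F N ε p k V := mul_nonneg hc (wilsonBGOfRecord_nonneg F N ε p k V)
  rw [Real.norm_eq_abs, abs_of_pos (Real.exp_pos _), Real.exp_le_one_iff]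
  linarith

/-- **★ THE OFFER IN ONE LINE (the measurable `U_k`-twin of record).**  For every `K, k, ε` there is a MEASURABLE `f` with: the `IsBackground` ∕ junk-default
contract of `Uk` (§1); the same Wilson-action value as `U_k` at EVERY configuration; the same minimal orbit as `U_k` wherever [B11] Thm 1's existence-and-
uniqueness holds (DISPLAYED); and measurable critical configurations `W ↦ M^j(f W)` at every level `j` — i.e. after the one-token re-point `Uk := f` the
binder (H-U) and its images (`measurable_critCfgOfRecord_of`, `measurable_chiFix29OfRecord_of`, `integrable_betaInput_stage13_of_measurableUk`) are theorems,
while `wilsonBGOfRecord` is unchanged.  Nothing re-pointed here. [cite: Balaban1987RG1, (0.21) p.256, (1.1) p.260, (2.3) p.265; Balaban1985Variational, Thm 1 p.279] -/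
theorem exists_measurable_Uk_twin (K k : ℕ) (ε : ℝ) :
    ∃ f : GaugeField (F.P K) k (SU N) → GaugeField (F.P K) 0 (SU N), Measurable f ∧
      (∀ V, UkExists F N K k ε V → IsBackground (avOfRecord F N K) (bgReg F N K k ε) k V (f V)) ∧
      (∀ V, ¬ UkExists F N K k ε V → f V = Uk F N K k ε V) ∧
      (∀ V, wilsonAction4 (f V) = wilsonAction4 (Uk F N K k ε V)) ∧
      (∀ V, UkExists F N K k ε V → UniqueUkOrbit F N K k ε V → OrbitRel k (Uk F N K k ε V) (f V)) ∧
      (∀ j, Measurable fun W => Averaging.iter (avOfRecord F N K) j (f W)) := by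
  obtain ⟨f, hfm, hsel, hout⟩ := exists_measurable_isBackground_selector (F := F) (N := N) K k ε
  exact ⟨f, hfm, hsel, fun V h => selector_eq_Uk_of_not hout h, wilsonAction4_eq_Uk_of_selector hsel hout,
    fun V h hu => orbitRel_Uk_of_selector hsel h hu, measurable_iter_comp_of_measurable hfm⟩

end Summit.QuantumFields.YangMills.BalabanUVNodes.N09UkMeasurableSelector

end
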